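import Summits.AtomisticToContinuum.HydrodynamicLimit.Theorems.InformationPercolationEngineChaosClosesEulerShellMaster
import Summits.AtomisticToContinuum.HydrodynamicLimit.Theorems.InformationPercolationEngineChaosClosesEulerShellFar
import Literature.Analysis.FluidPDE.MVEntropyMinimum
import HarnessLib

/-!
# BF18 shell for functions (crux `ChaosClosesEuler`, stmt-AtomisticToContinuum-15141, line `Sketch`,
# stub `stub_bf18Shell`) — helper 3b: the pointwise package for the CLAMPED relative energy

WHAT. `clamped_pointwise_package`: for an equation of state with the BF18 hypotheses (Gibbs, stability, `C²`,
`e > 0`, growth (3.1)) which moreover has positive pressure, the strong growth `|p| ≤ c_g ρe`, an exact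
temperature inversion, and vanishing pressure on cold and vacuum states (all automatic for the monatomic excess
class `p = ρϑχ(ρ)`, `e = 3ϑ/2`), a compact `K ⊂ (0,∞)²` of reference states and a bound `M` on the strong data,
there are `δ > 0`, clamp levels `a < b` and constants `C, c > 0` such that, writing `Z = clamp a b` and
`ℰ_Z = relEnergyZ` (BF (3.4)) for the clamped relative energy of a state against the data:

* (master, clamped)  `reducedRHS_Z ≤ C · ℰ_Z` on the whole open quadrant `{ρ > 0, E > 0}`;
* (sign)             `0 ≤ ℰ_Z` on the quadrant;
* (near coercivity)  `c((ρ−r)² + (ϑ−Θ)²) + |m − ρU|²/(2ρ) ≤ ℰ_Z` on the `δ`-boxes around `K`;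
* (far coercivity)   `c(1 + ρ + E + |m − ρU|²/(2ρ)) ≤ ℰ_Z` off the boxes;
* (cold states)      with the cut-off VALUE `a`: `reducedRHS_a ≤ C ℰ_a`, `c(1 + ρ + |m − ρU|²/(2ρ)) ≤ ℰ_a`;
* (vacuum)           `reducedRHS ≤ C ℰ_Z = C(E + p̃)` and `c(1 + E) ≤ ℰ_Z` for every cut-off.

WHY (no entropy minimum principle). The tree's master inequality bounds `reducedRHS_Z` by the FULL relative
energy `ℰ`, and `ℰ ≤ ℰ_Z` needs `s ≥ a`; a GENUINE bounded field has no such principle, so the lower clamp level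
is PRESCRIBED below `−(sup_K|μ̃| + 1)/inf_K Θ̃` (helper 1): on `{s < a}` the cut-off value is the constant `a`,
`ℰ_Z = |m−ρU|²/(2ρ) + E + ρ(−μ̃ − Θ̃a) + p̃` is linearly coercive and `reducedRHS_a` linearly bounded (helper 3a).

No named fact is invoked.
-/

noncomputable section

namespace Summit.AtomisticToContinuum.HydrodynamicLimit.Theorems.ChaosClosesEulerShell

open Set Function Metric Finset
open scoped Topology BigOperators
open Literature.Analysis.FluidPDE Literature.Analysis.FluidPDE.CompressibleEuler
open Literature.Analysis.FluidPDE.CompressibleEuler.StrongPointData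
open Literature.Analysis.FluidPDE.CompressibleEuler.EulerPhase
open Literature.Analysis.FluidPDE.CompressibleEuler.EulerEOS

variable {eos : EulerEOS}

/-- `reducedRHS` depends on the cut-off only through its value at the state's entropy. [folklore] -/
theorem reducedRHS_congr_cutoff {Z₁ Z₂ : ℝ → ℝ} (d : StrongPointData) {ρ E : ℝ}
    (h : Z₁ (eos.s ρ (stateTemp eos ρ E)) = Z₂ (eos.s ρ (stateTemp eos ρ E)))
    (m : EuclideanSpace ℝ (Fin 3)) : reducedRHS eos Z₁ d ρ E m = reducedRHS eos Z₂ d ρ E m := by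
  unfold reducedRHS; rw [h]

/-- `relEnergyZ` depends on the cut-off only through its value at the state's entropy. [folklore] -/
theorem relEnergyZ_congr_cutoff {Z₁ Z₂ : ℝ → ℝ} (d : StrongPointData) {ρ E : ℝ}
    (h : Z₁ (eos.s ρ (stateTemp eos ρ E)) = Z₂ (eos.s ρ (stateTemp eos ρ E)))
    (m : EuclideanSpace ℝ (Fin 3)) :
    d.relEnergyZ eos Z₁ (ρ, E, m) = d.relEnergyZ eos Z₂ (ρ, E, m) := by
  unfold relEnergyZ; simp only [dens_mk, ien_mk, mom_mk]; rw [h]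

/-- Below the lower level the clamp takes the value `a`. [folklore] -/
theorem clamp_eq_left {a b x : ℝ} (hx : x < a) : clamp a b x = a := by
  unfold clamp; exact max_eq_left ((min_le_left _ _).trans hx.le)

/-- **The pointwise package for the clamped relative energy** (module docstring). [cite: BrezinaFeireisl2018, §3.2.2] -/
theorem clamped_pointwise_package (hG : eos.IsGibbs) (hS : eos.IsThermodynamicallyStable)
    (hp2 : ContDiffOn ℝ 2 (uncurry eos.p) (Set.Ioi 0 ×ˢ Set.Ioi 0))
    (he2 : ContDiffOn ℝ 2 (uncurry eos.e) (Set.Ioi 0 ×ˢ Set.Ioi 0))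
    (hs2 : ContDiffOn ℝ 2 (uncurry eos.s) (Set.Ioi 0 ×ˢ Set.Ioi 0))
    (he : ∀ r θ : ℝ, 0 < r → 0 < θ → 0 < eos.e r θ)
    (hgrowth : ∃ c : ℝ, ∀ r θ : ℝ, 0 < r → 0 < θ →
      |eos.p r θ| ≤ c * (1 + r + r * |eos.s r θ| + r * eos.e r θ))
    (hsg : ∃ cg : ℝ, 0 ≤ cg ∧ ∀ r θ : ℝ, 0 < r → 0 < θ → |eos.p r θ| ≤ cg * (r * eos.e r θ))
    (hppos : ∀ r θ : ℝ, 0 < r → 0 < θ → 0 < eos.p r θ)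
    (htemp : ∀ r E : ℝ, 0 < r → 0 < E →
      0 < eos.temperature r E ∧ r * eos.e r (eos.temperature r E) = E)
    (hcold : ∀ ρ : ℝ, eos.p ρ (stateTemp eos ρ 0) = 0) (hvac : ∀ θ : ℝ, eos.p 0 θ = 0)
    {K : Set (ℝ × ℝ)} (hK : IsCompact K) (hKq : K ⊆ Set.Ioi 0 ×ˢ Set.Ioi 0) {M : ℝ} (hM : 0 ≤ M) :
    ∃ δ a b C c : ℝ, 0 < δ ∧ a < b ∧ 0 < C ∧ 0 < c ∧
      (∀ r Θ : ℝ, (r, Θ) ∈ K → δ < r ∧ δ < Θ) ∧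
      (∀ r Θ ρ ϑ : ℝ, (r, Θ) ∈ K → |ρ - r| ≤ δ → |ϑ - Θ| ≤ δ → a ≤ eos.s ρ ϑ ∧ eos.s ρ ϑ ≤ b) ∧
      (∀ d : StrongPointData, (d.r, d.Θ) ∈ K → d.Bounded M →
        ∀ (ρ E : ℝ) (m : EuclideanSpace ℝ (Fin 3)), 0 < ρ → 0 < E →
          (d.MassEq → d.TemperatureEq eos →
            reducedRHS eos (clamp a b) d ρ E m ≤ C * d.relEnergyZ eos (clamp a b) (ρ, E, m)) ∧
          0 ≤ d.relEnergyZ eos (clamp a b) (ρ, E, m) ∧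
          (|ρ - d.r| ≤ δ → |stateTemp eos ρ E - d.Θ| ≤ δ →
            c * ((ρ - d.r) ^ 2 + (stateTemp eos ρ E - d.Θ) ^ 2) +
              (∑ i, (m i - ρ * d.U i) ^ 2) / (2 * ρ) ≤ d.relEnergyZ eos (clamp a b) (ρ, E, m)) ∧
          (¬(|ρ - d.r| ≤ δ ∧ |stateTemp eos ρ E - d.Θ| ≤ δ) →
            c * (1 + ρ + E + (∑ i, (m i - ρ * d.U i) ^ 2) / (2 * ρ)) ≤
              d.relEnergyZ eos (clamp a b) (ρ, E, m))) ∧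
      (∀ d : StrongPointData, (d.r, d.Θ) ∈ K → d.Bounded M →
        ∀ (ρ : ℝ) (m : EuclideanSpace ℝ (Fin 3)), 0 < ρ →
          reducedRHS eos (fun _ => a) d ρ 0 m ≤ C * d.relEnergyZ eos (fun _ => a) (ρ, 0, m) ∧
          c * (1 + ρ + (∑ i, (m i - ρ * d.U i) ^ 2) / (2 * ρ)) ≤ d.relEnergyZ eos (fun _ => a) (ρ, 0, m)) ∧
      (∀ d : StrongPointData, (d.r, d.Θ) ∈ K → d.Bounded M → ∀ (E : ℝ) (Z : ℝ → ℝ), 0 ≤ E →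
          reducedRHS eos Z d 0 E 0 ≤ C * d.relEnergyZ eos Z (0, E, 0) ∧
          c * (1 + E) ≤ d.relEnergyZ eos Z (0, E, 0)) := by
  -- Step 0: constants on `K`
  obtain ⟨μmax, hμmax0, hμmax⟩ := exists_nonneg_forall_abs_le_of_continuousOn hK
    (hG.continuousOn_chemPotential.mono hKq)
  obtain ⟨Θmin, hΘmin, hΘminle⟩ := hK.exists_forall_le' continuousOn_snd fun z hz => (hKq hz).2
  obtain ⟨pmin, hpmin, hpminle⟩ := hK.exists_forall_le'
    ((hG.1.continuousOn (s := Set.Ioi 0 ×ˢ Set.Ioi 0)).mono hKq) fun z hz => hppos z.1 z.2 (hKq hz).1 (hKq hz).2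
  obtain ⟨Pk, hPk0, hPk⟩ := exists_nonneg_forall_abs_le_of_continuousOn hK
    ((hG.1.continuousOn (s := Set.Ioi 0 ×ˢ Set.Ioi 0)).mono hKq)
  obtain ⟨S₀, hS₀0, hS₀⟩ := exists_nonneg_forall_abs_le_of_continuousOn hK
    ((hG.2.2.1.continuousOn (s := Set.Ioi 0 ×ˢ Set.Ioi 0)).mono hKq)
  obtain ⟨S₁, hS₁0, hS₁⟩ := exists_nonneg_forall_abs_le_of_continuousOn hK
    ((continuousOn_deriv_slice_fst hG.1 isOpen_quadrant le_rfl).mono hKq)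
  obtain ⟨S₂, hS₂0, hS₂⟩ := exists_nonneg_forall_abs_le_of_continuousOn hK
    ((continuousOn_deriv_slice_snd hG.1 isOpen_quadrant le_rfl).mono hKq)
  obtain ⟨rmin, hrmin, hrminle⟩ := hK.exists_forall_le' continuousOn_fst fun z hz => (hKq hz).1
  obtain ⟨Sk, hSk1, hSk2, hSk3, hSk0⟩ : ∃ Sk : ℝ, S₀ ≤ Sk ∧ S₁ ≤ Sk ∧ S₂ ≤ Sk ∧ 0 ≤ Sk :=
    ⟨S₀ + S₁ + S₂, by linarith, by linarith, by linarith, by positivity⟩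
  obtain ⟨cg, hcg0, hcg⟩ := hsg
  -- the prescribed lower clamp level and the master inequality
  set A : ℝ := -(μmax + 1) / Θmin with hA
  obtain ⟨δ₁, a, b, C₁, hδ₁, hab, haA, hC₁, hnear₁, hmaster⟩ :=
    master_pointwise_inequality_le hG hS hp2 he2 hs2 he hgrowth hK hKq hM A
  have hμa : ∀ r Θ : ℝ, (r, Θ) ∈ K → 1 ≤ -eos.chemPotential r Θ - Θ * a := by
    intro r Θ hrΘ
    have hΘ : Θmin ≤ Θ := hΘminle _ hrΘ
    have hΘpos : 0 < Θ := hΘmin.trans_le hΘ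
    have hμ := (abs_le.1 (hμmax _ hrΘ)).2
    have h1 : Θ * a ≤ Θ * A := mul_le_mul_of_nonneg_left haA hΘpos.le
    have h2 : -(Θ * A) = Θ * (μmax + 1) / Θmin := by simp only [hA]; ring
    have h3 : (μmax + 1) ≤ Θ * (μmax + 1) / Θmin := by
      rw [le_div_iff₀ hΘmin]; nlinarith
    simp only at hμ
    linarith
  -- coercivity constants
  obtain ⟨δ₂, c₂, hδ₂, hc₂, hbox₂, hcoer₂⟩ := relEnergyThermo_coercivity_near_far hG hS hK hKq
  obtain ⟨Cd, hCd, hCd'⟩ := density_le_of_relEnergyThermo hG hS hK hKq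
  obtain ⟨Ce, hCe, hCe'⟩ := energy_entropy_le_of_relEnergyThermo hG hS he hK hKq
  set δ : ℝ := min δ₁ δ₂ with hδdef
  have hδ : 0 < δ := lt_min hδ₁ hδ₂
  have hδδ₁ : δ ≤ δ₁ := min_le_left _ _
  have hδδ₂ : δ ≤ δ₂ := min_le_right _ _
  set c₀ : ℝ := min c₂ (c₂ * δ ^ 2) with hc₀
  have hc₀pos : 0 < c₀ := lt_min hc₂ (by positivity)
  -- the far constants
  set Zb : ℝ := max |a| |b| with hZb
  have hZb0 : 0 ≤ Zb := le_max_of_le_left (abs_nonneg a)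
  have haZb : |a| ≤ Zb := le_max_left _ _
  set Ec : ℝ := max 1 (1 / pmin) with hEc
  have hEc0 : 0 ≤ Ec := le_trans zero_le_one (le_max_left _ _)
  set Cfar : ℝ := 2 * (3 * M + (Sk + Zb) * M / 2) +
    ((3 * M * Pk + 3 * M * cg) + 2 * Sk * (M + 3 * M * M) * (1 / rmin + 1) +
      (Sk + Zb) * (M + 3 * M * M) + 3 / 2 * (Sk + Zb) * M) * Ec with hCfar
  have hCfar0 : 0 ≤ Cfar := by positivity
  set Cv : ℝ := (3 * M * Pk + 2 * Sk * (M + 3 * M * M)) / pmin with hCv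
  have hCv0 : 0 ≤ Cv := by positivity
  set Cbig : ℝ := 1 + (1 / c₀ + Cd * (1 / c₀ + 1) + Ce * (1 / c₀ + Cd * (1 / c₀ + 1) + 1)) with hCbig
  have hX0 : 0 ≤ 1 / c₀ + Cd * (1 / c₀ + 1) + Ce * (1 / c₀ + Cd * (1 / c₀ + 1) + 1) := by positivity
  have hCbig1 : 1 ≤ Cbig := by simp only [hCbig]; linarith
  have hCbig0 : 0 < Cbig := lt_of_lt_of_le zero_lt_one hCbig1
  set C : ℝ := max (max C₁ Cfar) (max Cv 1) with hCdef
  have hC1 : (1 : ℝ) ≤ C := (le_max_right _ _).trans (le_max_right _ _)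
  have hCpos : 0 < C := lt_of_lt_of_le zero_lt_one hC1
  have hCC₁ : C₁ ≤ C := (le_max_left _ _).trans (le_max_left _ _)
  have hCCfar : Cfar ≤ C := (le_max_right _ _).trans (le_max_left _ _)
  have hCCv : Cv ≤ C := (le_max_left _ _).trans (le_max_right _ _)
  set c : ℝ := min (min c₂ (min 1 pmin)) (1 / Cbig) with hcdef
  have hcpos : 0 < c := lt_min (lt_min hc₂ (lt_min zero_lt_one hpmin)) (by positivity)
  have hcc₂ : c ≤ c₂ := (min_le_left _ _).trans (min_le_left _ _)
  have hc1 : c ≤ 1 := (min_le_left _ _).trans ((min_le_right _ _).trans (min_le_left _ _))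
  have hcp : c ≤ pmin := (min_le_left _ _).trans ((min_le_right _ _).trans (min_le_right _ _))
  refine ⟨δ, a, b, C, c, hδ, hab, hCpos, hcpos, fun r Θ hrΘ =>
    ⟨lt_of_le_of_lt hδδ₂ (hbox₂ r Θ hrΘ).1, lt_of_le_of_lt hδδ₂ (hbox₂ r Θ hrΘ).2⟩,
    fun r Θ ρ ϑ hrΘ hρ hϑ => hnear₁ r Θ ρ ϑ hrΘ (hρ.trans hδδ₁) (hϑ.trans hδδ₁), ?_, ?_, ?_⟩
  · -- Step 1: quadrant states
    intro d hdK hB ρ E m hρ hE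
    have hr : 0 < d.r := (hKq hdK).1
    have hΘ : 0 < d.Θ := (hKq hdK).2
    obtain ⟨hθ, hEe⟩ := htemp ρ E hρ hE
    have hθ' : 0 < stateTemp eos ρ E := hθ
    have hEe' : ρ * eos.e ρ (stateTemp eos ρ E) = E := hEe
    have hw : ((ρ, E, m) : EulerPhase) ∈ phaseQuadrant := ⟨hρ, hE⟩
    have hE0 := relEnergyFull_nonneg hG hS d hr hΘ hρ hθ' m
    have hfull : relEnergyFull eos d ρ E m =
        (∑ i, (m i - ρ * d.U i) ^ 2) / (2 * ρ) + eos.relEnergyThermo d.r d.Θ ρ (stateTemp eos ρ E) := rfl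
    have hK0 : 0 ≤ (∑ i, (m i - ρ * d.U i) ^ 2) / (2 * ρ) := by positivity
    -- the two regimes of the cut-off
    by_cases hsa : a ≤ eos.s ρ (stateTemp eos ρ E)
    · -- `s ≥ a`: `ℰ ≤ ℰ_Z`
      have hle : relEnergyFull eos d ρ E m ≤ d.relEnergyZ eos (clamp a b) (ρ, E, m) :=
        relEnergyFull_le_relEnergyZ_of_entropy_ge (b := b) (w := (ρ, E, m)) d hr hΘ.le hw hEe' hsa
      have hZ0 : 0 ≤ d.relEnergyZ eos (clamp a b) (ρ, E, m) := hE0.trans hle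
      refine ⟨fun hmass hTeq => ?_, hZ0, fun hρδ hθδ => ?_, fun hfar => ?_⟩
      · calc reducedRHS eos (clamp a b) d ρ E m ≤ C₁ * relEnergyFull eos d ρ E m :=
              hmaster d hdK hB hmass hTeq ρ E m hρ hθ'
          _ ≤ C * d.relEnergyZ eos (clamp a b) (ρ, E, m) :=
              mul_le_mul hCC₁ hle hE0 hCpos.le
      · have hq := (hcoer₂ d.r d.Θ ρ (stateTemp eos ρ E) hdK hρ hθ').1 (hρδ.trans hδδ₂) (hθδ.trans hδδ₂)
        have : c * ((ρ - d.r) ^ 2 + (stateTemp eos ρ E - d.Θ) ^ 2) ≤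
            c₂ * ((ρ - d.r) ^ 2 + (stateTemp eos ρ E - d.Θ) ^ 2) :=
          mul_le_mul_of_nonneg_right hcc₂ (by positivity)
        linarith
      · -- far with `s ≥ a`: linear coercivity of `ℰ`
        have hfar' : δ ≤ |ρ - d.r| ∨ δ ≤ |stateTemp eos ρ E - d.Θ| := by
          rcases not_and_or.1 hfar with h | h
          · exact Or.inl (le_of_lt (not_le.1 h))
          · exact Or.inr (le_of_lt (not_le.1 h))
        obtain ⟨Rt, hRt⟩ : ∃ Rt, Rt = eos.relEnergyThermo d.r d.Θ ρ (stateTemp eos ρ E) := ⟨_, rfl⟩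
        have hRc₀ : c₀ ≤ Rt := by
          have hcf := hcoer₂ d.r d.Θ ρ (stateTemp eos ρ E) hdK hρ hθ'
          rw [← hRt] at hcf
          by_cases hfar₂ : δ₂ ≤ |ρ - d.r| ∨ δ₂ ≤ |stateTemp eos ρ E - d.Θ|
          · exact (min_le_left _ _).trans (hcf.2 hfar₂)
          · rcases not_or.1 hfar₂ with ⟨h1, h2⟩
            have hloc := hcf.1 (le_of_lt (not_le.1 h1)) (le_of_lt (not_le.1 h2))
            refine (min_le_right _ _).trans (le_trans ?_ hloc)
            refine mul_le_mul_of_nonneg_left ?_ hc₂.le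
            rcases hfar' with h | h
            · have h3 : δ ^ 2 ≤ (ρ - d.r) ^ 2 := by
                rw [← sq_abs (ρ - d.r)]; exact pow_le_pow_left₀ hδ.le h 2
              linarith only [h3, sq_nonneg (stateTemp eos ρ E - d.Θ)]
            · have h3 : δ ^ 2 ≤ (stateTemp eos ρ E - d.Θ) ^ 2 := by
                rw [← sq_abs (stateTemp eos ρ E - d.Θ)]; exact pow_le_pow_left₀ hδ.le h 2
              linarith only [h3, sq_nonneg (ρ - d.r)]
        have hRt0 : 0 ≤ Rt := hc₀pos.le.trans hRc₀
        have h1 : 1 ≤ 1 / c₀ * Rt := by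
          rw [one_div, ← div_eq_inv_mul, le_div_iff₀ hc₀pos]; linarith
        have hρC : ρ ≤ Cd * (1 / c₀ + 1) * Rt := by
          have := hCd' d.r d.Θ ρ (stateTemp eos ρ E) hdK hρ hθ'
          rw [← hRt] at this
          calc ρ ≤ Cd * (1 + Rt) := this
            _ ≤ Cd * (1 / c₀ * Rt + Rt) := mul_le_mul_of_nonneg_left (by linarith) hCd.le
            _ = Cd * (1 / c₀ + 1) * Rt := by ring
        have hEC : E ≤ Ce * (1 / c₀ + Cd * (1 / c₀ + 1) + 1) * Rt := by
          have := (hCe' d.r d.Θ ρ (stateTemp eos ρ E) hdK hρ hθ').1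
          rw [← hRt, hEe'] at this
          calc E ≤ Ce * (1 + ρ + Rt) := this
            _ ≤ Ce * (1 / c₀ * Rt + Cd * (1 / c₀ + 1) * Rt + Rt) :=
                mul_le_mul_of_nonneg_left (by linarith) hCe.le
            _ = Ce * (1 / c₀ + Cd * (1 / c₀ + 1) + 1) * Rt := by ring
        have h4 : (∑ i, (m i - ρ * d.U i) ^ 2) / (2 * ρ) ≤
            Cbig * ((∑ i, (m i - ρ * d.U i) ^ 2) / (2 * ρ)) := le_mul_of_one_le_left hK0 hCbig1
        have hsum : 1 + ρ + E + (∑ i, (m i - ρ * d.U i) ^ 2) / (2 * ρ) ≤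
            Cbig * ((∑ i, (m i - ρ * d.U i) ^ 2) / (2 * ρ) + Rt) := by
          have e : Cbig * ((∑ i, (m i - ρ * d.U i) ^ 2) / (2 * ρ) + Rt) =
              Cbig * ((∑ i, (m i - ρ * d.U i) ^ 2) / (2 * ρ)) + Rt +
                (1 / c₀ * Rt + Cd * (1 / c₀ + 1) * Rt + Ce * (1 / c₀ + Cd * (1 / c₀ + 1) + 1) * Rt) := by
            simp only [hCbig]; ring
          rw [e]
          linarith
        calc c * (1 + ρ + E + (∑ i, (m i - ρ * d.U i) ^ 2) / (2 * ρ))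
            ≤ 1 / Cbig * (Cbig * ((∑ i, (m i - ρ * d.U i) ^ 2) / (2 * ρ) + Rt)) :=
              mul_le_mul (min_le_right _ _) hsum (by positivity) (by positivity)
          _ = (∑ i, (m i - ρ * d.U i) ^ 2) / (2 * ρ) + Rt := by field_simp
          _ = relEnergyFull eos d ρ E m := by rw [hfull, hRt]
          _ ≤ _ := hle
    · -- `s < a`: the cut-off value is the constant `a`
      push Not at hsa
      have hZa : clamp a b (eos.s ρ (stateTemp eos ρ E)) = (fun _ : ℝ => a) (eos.s ρ (stateTemp eos ρ E)) :=
        clamp_eq_left hsa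
      have hRHS : reducedRHS eos (clamp a b) d ρ E m = reducedRHS eos (fun _ => a) d ρ E m :=
        reducedRHS_congr_cutoff d hZa m
      have hEZ : d.relEnergyZ eos (clamp a b) (ρ, E, m) = d.relEnergyZ eos (fun _ => a) (ρ, E, m) :=
        relEnergyZ_congr_cutoff d hZa m
      obtain ⟨hR0, hGR⟩ := far_const_coercive (eos := eos) d hρ hE.le (hμa d.r d.Θ hdK) hpmin
        (hpminle _ hdK) m (ζ := a)
      have hform := relEnergyZ_const_kinetic_form (eos := eos) d a hρ.ne' E m
      -- linear lower bound
      have hlow : c * (1 + ρ + E + (∑ i, (m i - ρ * d.U i) ^ 2) / (2 * ρ)) ≤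
          d.relEnergyZ eos (fun _ => a) (ρ, E, m) := by
        rw [hform]
        have h1 : ρ * 1 ≤ ρ * (-eos.chemPotential d.r d.Θ - d.Θ * a) :=
          mul_le_mul_of_nonneg_left (hμa d.r d.Θ hdK) hρ.le
        have h2 : pmin ≤ eos.p d.r d.Θ := hpminle _ hdK
        have h3 : c * (1 + ρ + E + (∑ i, (m i - ρ * d.U i) ^ 2) / (2 * ρ)) ≤
            1 * (ρ + E + (∑ i, (m i - ρ * d.U i) ^ 2) / (2 * ρ)) + pmin * 1 := by
          have e : c * (1 + ρ + E + (∑ i, (m i - ρ * d.U i) ^ 2) / (2 * ρ)) =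
              c * (ρ + E + (∑ i, (m i - ρ * d.U i) ^ 2) / (2 * ρ)) + c * 1 := by ring
          rw [e]
          exact add_le_add (mul_le_mul_of_nonneg_right hc1 (by positivity))
            (mul_le_mul_of_nonneg_right hcp zero_le_one)
        linarith
      have hZ0 : 0 ≤ d.relEnergyZ eos (fun _ => a) (ρ, E, m) :=
        le_trans (by positivity) hlow
      refine ⟨fun hmass hTeq => ?_, hEZ ▸ hZ0, fun hρδ hθδ => ?_, fun _ => hEZ ▸ hlow⟩
      · rw [hRHS, hEZ]
        have hgr : |eos.p ρ (stateTemp eos ρ E)| ≤ cg * E := by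
          have := hcg ρ (stateTemp eos ρ E) hρ hθ'; rwa [hEe'] at this
        have hfar := reducedRHS_le_far_const (eos := eos) (m := m) (ζ := a) hM hPk0 hSk0 hZb0 hcg0 hEc0
          hrmin (hrminle _ hdK) hρ.le hE.le hB (hPk _ hdK) ((hS₀ _ hdK).trans hSk1)
          ((hS₁ _ hdK).trans hSk2) ((hS₂ _ hdK).trans hSk3) haZb hgr hR0 hGR
        rw [← hCfar] at hfar
        have e : ρ * (∑ i, (m i / ρ - d.U i) ^ 2) / 2 +
            (d.relEnergyZ eos (fun _ => a) (ρ, E, m) - ρ * (∑ i, (m i / ρ - d.U i) ^ 2) / 2) =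
            d.relEnergyZ eos (fun _ => a) (ρ, E, m) := by ring
        rw [e] at hfar
        exact hfar.trans (mul_le_mul_of_nonneg_right hCCfar hZ0)
      · -- near the reference state the entropy is `≥ a`: contradiction
        exact absurd (hnear₁ d.r d.Θ ρ (stateTemp eos ρ E) hdK (hρδ.trans hδδ₁) (hθδ.trans hδδ₁)).1
          (not_le.2 hsa)
  · -- Step 2: cold states, cut-off value `a`
    intro d hdK hB ρ m hρ
    have hr : 0 < d.r := (hKq hdK).1
    obtain ⟨hR0, hGR⟩ := far_const_coercive (eos := eos) d hρ le_rfl (hμa d.r d.Θ hdK) hpmin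
      (hpminle _ hdK) m (ζ := a)
    have hform := relEnergyZ_const_kinetic_form (eos := eos) d a hρ.ne' 0 m
    have hlow : c * (1 + ρ + (∑ i, (m i - ρ * d.U i) ^ 2) / (2 * ρ)) ≤
        d.relEnergyZ eos (fun _ => a) (ρ, 0, m) := by
      rw [hform]
      have h1 : ρ * 1 ≤ ρ * (-eos.chemPotential d.r d.Θ - d.Θ * a) :=
        mul_le_mul_of_nonneg_left (hμa d.r d.Θ hdK) hρ.le
      have h2 : pmin ≤ eos.p d.r d.Θ := hpminle _ hdK
      have hK0 : 0 ≤ (∑ i, (m i - ρ * d.U i) ^ 2) / (2 * ρ) := by positivity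
      have h3 : c * (1 + ρ + (∑ i, (m i - ρ * d.U i) ^ 2) / (2 * ρ)) ≤
          1 * (ρ + (∑ i, (m i - ρ * d.U i) ^ 2) / (2 * ρ)) + pmin * 1 := by
        have e : c * (1 + ρ + (∑ i, (m i - ρ * d.U i) ^ 2) / (2 * ρ)) =
            c * (ρ + (∑ i, (m i - ρ * d.U i) ^ 2) / (2 * ρ)) + c * 1 := by ring
        rw [e]
        exact add_le_add (mul_le_mul_of_nonneg_right hc1 (by positivity))
          (mul_le_mul_of_nonneg_right hcp zero_le_one)
      linarith
    have hZ0 : 0 ≤ d.relEnergyZ eos (fun _ => a) (ρ, 0, m) := le_trans (by positivity) hlow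
    refine ⟨?_, hlow⟩
    have hgr : |eos.p ρ (stateTemp eos ρ 0)| ≤ cg * 0 := by rw [hcold ρ]; simp
    have hfar := reducedRHS_le_far_const (eos := eos) (m := m) (ζ := a) hM hPk0 hSk0 hZb0 hcg0 hEc0
      hrmin (hrminle _ hdK) hρ.le le_rfl hB (hPk _ hdK) ((hS₀ _ hdK).trans hSk1)
      ((hS₁ _ hdK).trans hSk2) ((hS₂ _ hdK).trans hSk3) haZb hgr hR0 (by simpa [hEc] using hGR)
    rw [← hCfar] at hfar
    have e : ρ * (∑ i, (m i / ρ - d.U i) ^ 2) / 2 +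
        (d.relEnergyZ eos (fun _ => a) (ρ, 0, m) - ρ * (∑ i, (m i / ρ - d.U i) ^ 2) / 2) =
        d.relEnergyZ eos (fun _ => a) (ρ, 0, m) := by ring
    rw [e] at hfar
    exact hfar.trans (mul_le_mul_of_nonneg_right hCCfar hZ0)
  · -- Step 3: the vacuum
    intro d hdK hB E Z hE
    have hr : 0 < d.r := (hKq hdK).1
    have hp : pmin ≤ eos.p d.r d.Θ := hpminle _ hdK
    have hEZ : d.relEnergyZ eos Z ((0 : ℝ), E, (0 : EuclideanSpace ℝ (Fin 3))) = E + eos.p d.r d.Θ :=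
      relEnergyZ_vacuum d Z E
    have hlow : c * (1 + E) ≤ d.relEnergyZ eos Z (0, E, 0) := by
      rw [hEZ]
      have : c * (1 + E) = c * E + c := by ring
      rw [this]
      exact add_le_add (le_trans (mul_le_mul_of_nonneg_right hc1 hE) (by rw [one_mul])) (hcp.trans hp)
    refine ⟨?_, hlow⟩
    rw [reducedRHS_vacuum d Z E hr.ne' hvac, hEZ, pt_add_sum]
    have h1 : |eos.p d.r d.Θ * d.divU| ≤ Pk * (3 * M) := abs_mul_le_of_le (hPk _ hdK) hB.abs_divU_le
    have h2 : |d.pρ eos * d.Dtr + d.pϑ eos * d.DtΘ| ≤ 2 * Sk * (M + 3 * M * M) := by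
      refine (abs_add_le _ _).trans ?_
      have e1 : |d.pρ eos * d.Dtr| ≤ Sk * (M + 3 * M * M) :=
        abs_mul_le_of_le ((hS₁ _ hdK).trans hSk2) hB.abs_Dtr_le
      have e2 : |d.pϑ eos * d.DtΘ| ≤ Sk * (M + 3 * M * M) :=
        abs_mul_le_of_le ((hS₂ _ hdK).trans hSk3) hB.abs_DtΘ_le
      linarith
    have h3 : eos.p d.r d.Θ * d.divU + (d.pρ eos * d.Dtr + d.pϑ eos * d.DtΘ) ≤
        3 * M * Pk + 2 * Sk * (M + 3 * M * M) := by
      linarith [le_abs_self (eos.p d.r d.Θ * d.divU), le_abs_self (d.pρ eos * d.Dtr + d.pϑ eos * d.DtΘ)]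
    have h4 : 3 * M * Pk + 2 * Sk * (M + 3 * M * M) = Cv * pmin := by
      simp only [hCv]; field_simp
    have h5 : Cv * pmin ≤ C * (E + eos.p d.r d.Θ) := by
      calc Cv * pmin ≤ Cv * (E + eos.p d.r d.Θ) := mul_le_mul_of_nonneg_left (by linarith) hCv0
        _ ≤ C * (E + eos.p d.r d.Θ) := mul_le_mul_of_nonneg_right hCCv (by linarith)
    linarith

/-- REGISTERED SUB-GOAL `stub_bf18ShellPointwise` of the line `Sketch` (helper 3b of `stub_bf18Shell`): the
pointwise package for the clamped relative energy, all hypotheses explicit.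
[cite: BrezinaFeireisl2018, §3.2.2 (3.8)–(3.11)] -/
theorem stub_bf18ShellPointwise :
    ∀ (eos : EulerEOS), eos.IsGibbs → eos.IsThermodynamicallyStable →
      ContDiffOn ℝ 2 (Function.uncurry eos.p) (Set.Ioi 0 ×ˢ Set.Ioi 0) →
      ContDiffOn ℝ 2 (Function.uncurry eos.e) (Set.Ioi 0 ×ˢ Set.Ioi 0) →
      ContDiffOn ℝ 2 (Function.uncurry eos.s) (Set.Ioi 0 ×ˢ Set.Ioi 0) →
      (∀ r θ : ℝ, 0 < r → 0 < θ → 0 < eos.e r θ) →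
      (∃ c : ℝ, ∀ r θ : ℝ, 0 < r → 0 < θ → |eos.p r θ| ≤ c * (1 + r + r * |eos.s r θ| + r * eos.e r θ)) →
      (∃ cg : ℝ, 0 ≤ cg ∧ ∀ r θ : ℝ, 0 < r → 0 < θ → |eos.p r θ| ≤ cg * (r * eos.e r θ)) →
      (∀ r θ : ℝ, 0 < r → 0 < θ → 0 < eos.p r θ) →
      (∀ r E : ℝ, 0 < r → 0 < E → 0 < eos.temperature r E ∧ r * eos.e r (eos.temperature r E) = E) →
      (∀ ρ : ℝ, eos.p ρ (stateTemp eos ρ 0) = 0) → (∀ θ : ℝ, eos.p 0 θ = 0) →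
      ∀ (K : Set (ℝ × ℝ)), IsCompact K → K ⊆ Set.Ioi 0 ×ˢ Set.Ioi 0 → ∀ (M : ℝ), 0 ≤ M →
      ∃ δ a b C c : ℝ, 0 < δ ∧ a < b ∧ 0 < C ∧ 0 < c ∧
        (∀ r Θ : ℝ, (r, Θ) ∈ K → δ < r ∧ δ < Θ) ∧
        (∀ r Θ ρ ϑ : ℝ, (r, Θ) ∈ K → |ρ - r| ≤ δ → |ϑ - Θ| ≤ δ → a ≤ eos.s ρ ϑ ∧ eos.s ρ ϑ ≤ b) ∧
        (∀ d : StrongPointData, (d.r, d.Θ) ∈ K → d.Bounded M →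
          ∀ (ρ E : ℝ) (m : EuclideanSpace ℝ (Fin 3)), 0 < ρ → 0 < E →
            (d.MassEq → d.TemperatureEq eos →
              reducedRHS eos (clamp a b) d ρ E m ≤ C * d.relEnergyZ eos (clamp a b) (ρ, E, m)) ∧
            0 ≤ d.relEnergyZ eos (clamp a b) (ρ, E, m) ∧
            (|ρ - d.r| ≤ δ → |stateTemp eos ρ E - d.Θ| ≤ δ →
              c * ((ρ - d.r) ^ 2 + (stateTemp eos ρ E - d.Θ) ^ 2) +
                (∑ i, (m i - ρ * d.U i) ^ 2) / (2 * ρ) ≤ d.relEnergyZ eos (clamp a b) (ρ, E, m)) ∧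
            (¬(|ρ - d.r| ≤ δ ∧ |stateTemp eos ρ E - d.Θ| ≤ δ) →
              c * (1 + ρ + E + (∑ i, (m i - ρ * d.U i) ^ 2) / (2 * ρ)) ≤
                d.relEnergyZ eos (clamp a b) (ρ, E, m))) ∧
        (∀ d : StrongPointData, (d.r, d.Θ) ∈ K → d.Bounded M →
          ∀ (ρ : ℝ) (m : EuclideanSpace ℝ (Fin 3)), 0 < ρ →
            reducedRHS eos (fun _ => a) d ρ 0 m ≤ C * d.relEnergyZ eos (fun _ => a) (ρ, 0, m) ∧
            c * (1 + ρ + (∑ i, (m i - ρ * d.U i) ^ 2) / (2 * ρ)) ≤ d.relEnergyZ eos (fun _ => a) (ρ, 0, m)) ∧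
        (∀ d : StrongPointData, (d.r, d.Θ) ∈ K → d.Bounded M → ∀ (E : ℝ) (Z : ℝ → ℝ), 0 ≤ E →
            reducedRHS eos Z d 0 E 0 ≤ C * d.relEnergyZ eos Z (0, E, 0) ∧
            c * (1 + E) ≤ d.relEnergyZ eos Z (0, E, 0)) :=
  fun _eos hG hS hp2 he2 hs2 he hgrowth hsg hppos htemp hcold hvac _K hK hKq _M hM =>
    clamped_pointwise_package hG hS hp2 he2 hs2 he hgrowth hsg hppos htemp hcold hvac hK hKq hM

end Summit.AtomisticToContinuum.HydrodynamicLimit.Theorems.ChaosClosesEulerShell
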